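import Summits.PneNP.PneNP.Theorems.ExpanderLinearGeneratorsLinearGeneratorModPFregeHardMod2Chain
import Summits.PneNP.PneNP.Theorems.ExpanderLinearGeneratorsLinearGeneratorModPFregeHardMod2Fold
import Summits.PneNP.PneNP.Theorems.ExpanderLinearGeneratorsLinearGeneratorModPFregeHardMod2Transfer
import Summits.PneNP.PneNP.Theorems.ExpanderLinearGeneratorsLinearGeneratorModPFregeHardMod2Sigma
import Summits.PneNP.PneNP.Theorems.ExpanderLinearGeneratorsLinearGeneratorModPFregeHardMod2Kinds
import Summits.PneNP.PneNP.Theorems.ExpanderLinearGeneratorsLinearGeneratorModPFregeHardMod2Prelim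
import HarnessLib

/-!
# `MOD₂` summation, concrete level, VI: every unsolvable system over `𝔽₂` has a depth-35
`textbookFrege(MOD₂)`-refutation of its `sumEncoding` (raw size bound)

Support file for item `stmt-PneNP-11444` (`LinearGeneratorModPFregeHard`), calibration line "for
`p = 2` the rung fails: `MOD₂` gates sum the certificate rows in polynomial size".  This is the
assembly: the kinds of `…Mod2Kinds.lean` instantiate the abstract chain (`…Mod2Chain.lean`), the
refuted context is folded and extracted (`…Mod2Fold.lean`), the `MOD₂` substitution
(`…Mod2Sigma.lean`) turns the skeleta into axioms and the transfer (`…Mod2Transfer.lean`) yields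
the `F₃₅(MOD₂)`-proof of `¬ofCNF (sumEncoding 1 E)`.  The size is recorded RAW (in terms of the
explicit budgets of the construction); `…Mod2Easy.lean` turns it into a polynomial bound.

No definitions are introduced; the atoms, skeleta, hypothesis list, context and parameters are
built inside the proof.

Sources: S. Buss et al., Comput. Complexity 6 (1996/97), Def. 1.1; the summation argument is the
folklore remark of the item's docstring ("for `p = 2` … `MOD₂` gates sum the certificate rows in
polynomial size").
-/

set_option linter.dupNamespace false -- `Summit.PneNP.PneNP.…`: summit = sub-problem (D-0017)

namespace Summit.PneNP.PneNP.Theorems.ModTwo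

open Literature.Computability.Complexity Literature.Computability.Complexity.PropForm
open Literature.Computability.MetaComplexity Literature.Computability.MetaComplexity.DepthFrege
open Literature.Computability.MetaComplexity.TextbookFrege (disjList disjList_nil disjList_cons)
open Literature.Computability.MetaComplexity.KEval (litForm clauseForm clauseForm_cons ofCNF_cons)
open scoped symmDiff

/-- **Raw refutation theorem.** For every unsolvable `E : Fin m → LinEqMod 2 n` there is a
`textbookFrege(MOD₂)`-proof of `¬ ofCNF (sumEncoding 1 E)` of depth `≤ 35` whose size is bounded
by the explicit budgets of the construction: with `φ = sumEncoding 1 E`, `L = 2^6002`,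
`hl ≤ (2m+1)(2n+2)` hypotheses, `W = |φ| + hl + n + 6015`, `M ≤ 25 hl + |ofCNF φ| + 41`, ticks
`t ≤ (L+3)(n+1) + (2|φ|+m)((L+3)(n+1)+2n+5) + m(L+(L+2)(n+1)+5) + n(L+2) + L + 5`, the size is
`≤ (sz + 6 hl + 1)·(2 sz + 1)·(n+1)` for `sz = ((t + 3|φ| + 3 hl + 4)(300(W+3)² + 100) + 8)·64(W+4)·(M+14)`.
[Buss et al. 1997, Def. 1.1] [folklore] -/
theorem exists_modTwo_refutation_raw {n m : ℕ} (E : Fin m → LinEqMod 2 n)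
    (hE : ¬ SystemSat E Finset.univ) :
    ∃ (hl t W M : ℕ) (π : List (PropFormMod 2 ℕ)),
      textbookFrege.IsModDepthProofOf 35 π
        (PropFormMod.ofPropForm (neg (PropForm.ofCNF (sumEncoding 1 E)))) ∧
      hl ≤ (2 * m + 1) * (2 * n + 2) ∧
      W = (sumEncoding 1 E).length + hl + n + 6015 ∧
      M ≤ 25 * hl + (PropForm.ofCNF (sumEncoding 1 E)).size + 41 ∧
      t ≤ (2 ^ 6002 + 3) * (n + 1) +
          (2 * (sumEncoding 1 E).length + m) * ((2 ^ 6002 + 3) * (n + 1) + 2 * n + 5) +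
          m * (2 ^ 6002 + (2 ^ 6002 + 2) * (n + 1) + 5) + n * (2 ^ 6002 + 2) + 2 ^ 6002 + 5 ∧
      modProofSize π ≤
        (((t + 3 * (sumEncoding 1 E).length + 3 * hl + 4) * (300 * (W + 3) * (W + 3) + 100) + 8) *
            (64 * (W + 4) * (M + 14)) + 6 * hl + 1) *
          ((2 * (((t + 3 * (sumEncoding 1 E).length + 3 * hl + 4) *
            (300 * (W + 3) * (W + 3) + 100) + 8) * (64 * (W + 4) * (M + 14))) + 1) * (n + 1)) := by
  obtain ⟨Dof, row, brow, q, hqm, hacc, hD0, hDn, heven, hodd, hcl, hcount⟩ :=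
    exists_certificate_kinds E hE
  have hc2 : ∀ c : ZMod 2, c = 0 ∨ c = 1 := by decide
  set φ := sumEncoding 1 E with hφ
  -- atoms and skeleta
  let zv : ZMod 2 → ℕ → ℕ → ℕ := fun c k κ => n + Nat.pair (Nat.pair c.val k) κ
  let Y : ℕ → ℕ → PropForm ℕ := fun k κ => if k ∈ Dof κ then var k else const false
  let H3 : ZMod 2 → ℕ → ℕ → PropForm ℕ := fun c k κ => PropForm.biimp (var (zv c (k + 1) κ))
    (disj (conj (var (zv c k κ)) (neg (Y k κ))) (conj (var (zv (c - 1) k κ)) (Y k κ)))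
  have hH3₀ : ∀ k κ, H3 0 k κ = PropForm.biimp (var (zv 0 (k + 1) κ))
      (disj (conj (var (zv 0 k κ)) (neg (Y k κ))) (conj (var (zv 1 k κ)) (Y k κ))) :=
    fun k κ => rfl
  have hH3₁ : ∀ k κ, H3 1 k κ = PropForm.biimp (var (zv 1 (k + 1) κ))
      (disj (conj (var (zv 1 k κ)) (neg (Y k κ))) (conj (var (zv 0 k κ)) (Y k κ))) :=
    fun k κ => rfl
  have hYdef : ∀ k κ, Y k κ = if k ∈ Dof κ then var k else const false := fun _ _ => rfl
  have hY : ∀ k κ, Y k κ = var k ∨ Y k κ = const false := by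
    intro k κ; rw [hYdef]; split_ifs <;> simp
  have hH3b : ∀ (c : ZMod 2) k κ, (H3 c k κ).size = 23 ∧ (neg (H3 c k κ)).size = 24 ∧
      (H3 c k κ).altDepth ≤ 6 ∧ (neg (H3 c k κ)).altDepth ≤ 7 := by
    intro c k κ
    obtain rfl | rfl := hc2 c
    · exact bounds_H3 zv Y hY (hH3₀ k κ)
    · exact bounds_H3 zv Y hY (hH3₁ k κ)
  -- kinds and hypotheses
  let KL : List ℕ := (List.range (q + 1)).map (fun t => 2 * t) ++
    (List.range q).map (fun t => 2 * row t + 1)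
  let HL : List (PropForm ℕ) := KL.flatMap (fun κ => [var (zv 0 0 κ), neg (var (zv 1 0 κ))] ++
    (List.range n).flatMap (fun k => [H3 0 k κ, H3 1 k κ]))
  have hKLlen : KL.length = 2 * q + 1 := by simp [KL]; ring
  have hHLlen : HL.length = (2 * q + 1) * (2 * n + 2) := by
    rw [← hKLlen]
    refine length_flatMap_of_const _ _ KL fun κ _ => ?_
    rw [List.length_append, length_flatMap_of_const _ 2 (List.range n) (fun _ _ => rfl),
      List.length_range]
    simp; ring
  have hKa : ∀ t, t ≤ q → 2 * t ∈ KL := fun t ht =>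
    List.mem_append_left _ (List.mem_map.2 ⟨t, List.mem_range.2 (Nat.lt_succ_of_le ht), rfl⟩)
  have hKr : ∀ t, t < q → 2 * row t + 1 ∈ KL := fun t ht =>
    List.mem_append_right _ (List.mem_map.2 ⟨t, List.mem_range.2 ht, rfl⟩)
  have hHLmem : ∀ κ ∈ KL, var (zv 0 0 κ) ∈ HL ∧ neg (var (zv 1 0 κ)) ∈ HL ∧
      ∀ k, k < n → H3 0 k κ ∈ HL ∧ H3 1 k κ ∈ HL := by
    intro κ hκ
    refine ⟨List.mem_flatMap.2 ⟨κ, hκ, by simp⟩, List.mem_flatMap.2 ⟨κ, hκ, by simp⟩,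
      fun k hk => ⟨List.mem_flatMap.2 ⟨κ, hκ, ?_⟩, List.mem_flatMap.2 ⟨κ, hκ, ?_⟩⟩⟩ <;>
      exact List.mem_append_right _ (List.mem_flatMap.2 ⟨k, List.mem_range.2 hk, by simp⟩)
  have hHLcases : ∀ H ∈ HL, ∃ κ ∈ KL, H = var (zv 0 0 κ) ∨ H = neg (var (zv 1 0 κ)) ∨
      ∃ k, k < n ∧ (H = H3 0 k κ ∨ H = H3 1 k κ) := by
    intro H hH
    obtain ⟨κ, hκ, hH⟩ := List.mem_flatMap.1 hH
    refine ⟨κ, hκ, ?_⟩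
    simp only [List.mem_append, List.mem_cons, List.not_mem_nil, or_false, List.mem_flatMap,
      List.mem_range] at hH
    rcases hH with (rfl | rfl) | ⟨k, hk, rfl | rfl⟩
    · exact Or.inl rfl
    · exact Or.inr (Or.inl rfl)
    · exact Or.inr (Or.inr ⟨k, hk, Or.inl rfl⟩)
    · exact Or.inr (Or.inr ⟨k, hk, Or.inr rfl⟩)
  have hHLbd : ∀ H ∈ HL, H.size ≤ 23 ∧ (neg H).size ≤ 24 ∧ (neg H).altDepth ≤ 7 := by
    intro H hH
    obtain ⟨κ, -, rfl | rfl | ⟨k, -, rfl | rfl⟩⟩ := hHLcases H hH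
    · simp [size, altDepth, altDepthAux]
    · simp [size, altDepth, altDepthAux]
    · exact ⟨le_of_eq (hH3b 0 k κ).1, le_of_eq (hH3b 0 k κ).2.1, (hH3b 0 k κ).2.2.2⟩
    · exact ⟨le_of_eq (hH3b 1 k κ).1, le_of_eq (hH3b 1 k κ).2.1, (hH3b 1 k κ).2.2.2⟩
  -- the context and the goal formula
  let K : List (PropForm ℕ) := (φ.map fun C => neg (clauseForm C)) ++ HL.map neg
  have hKlen : K.length = φ.length + HL.length := by simp [K]
  have hKhyp : ∀ H ∈ HL, neg H ∈ K := fun H hH =>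
    List.mem_append_right _ (List.mem_map_of_mem hH)
  let G : PropForm ℕ := HL.foldr (fun H R => disj (neg H) R) (neg (PropForm.ofCNF φ))
  obtain ⟨hGsize', hGge'⟩ :=
    size_foldr_negDisj (neg (PropForm.ofCNF φ)) HL (fun H hH => (hHLbd H hH).1)
  have hGsize : G.size ≤ (23 + 2) * HL.length + ((PropForm.ofCNF φ).size + 1) := hGsize'
  have hGge : (PropForm.ofCNF φ).size + 1 ≤ G.size := hGge'
  clear hGsize' hGge'
  have hGdepth : G.altDepth ≤ 8 := (altDepth_foldr_negDisj_le (neg (PropForm.ofCNF φ))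
    ((altDepth_neg_ofCNF_le φ).trans (by norm_num)) HL (fun H hH => (hHLbd H hH).2.2)).1
  -- parameters
  let Q : SPrm :=
    { D := 8, M := G.size + 40, Λ := 64 * (K.length + n + 6015 + 4), W := K.length + n + 6015,
      hΛ := le_rfl, hM := by omega, hD := by norm_num }
  have hQ : 8 ≤ Q.D ∧ 40 ≤ Q.M := ⟨le_rfl, Nat.le_add_left _ _⟩
  have hGbase : Base Q G := ⟨hGdepth, Nat.le_add_right _ _⟩
  have hKb : ∀ A ∈ K, Base Q A := by
    intro A hA
    rcases List.mem_append.1 hA with hA | hA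
    · obtain ⟨C, hC, rfl⟩ := List.mem_map.1 hA
      refine base_neg_clauseForm hC (by norm_num) ?_
      show (PropForm.ofCNF φ).size + 1 ≤ G.size + 40
      omega
    · obtain ⟨H, hH, rfl⟩ := List.mem_map.1 hA
      exact ⟨((hHLbd H hH).2.2).trans (by norm_num), ((hHLbd H hH).2.1).trans (by
        show 24 ≤ G.size + 40; omega)⟩
  -- the chain
  have hK3 : ∀ (c : ZMod 2) k κ, k < n → κ ∈ KL → neg (H3 c k κ) ∈ K := by
    intro c k κ hk hκ
    obtain rfl | rfl := hc2 c
    · exact hKhyp _ ((hHLmem κ hκ).2.2 k hk).1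
    · exact hKhyp _ ((hHLmem κ hκ).2.2 k hk).2
  have hchain := sq_chain zv Y H3 n K hH3₀ hH3₁ Dof hYdef (fun i => 2 * i + 1) (fun t => 2 * t)
    row brow q
    (fun t k => conj (disj (neg (var (zv 0 k (2 * t)))) (disj (neg (var (zv 0 k (2 * row t + 1))))
        (var (zv 0 k (2 * (t + 1))))))
      (conj (disj (neg (var (zv 0 k (2 * t)))) (disj (neg (var (zv 1 k (2 * row t + 1))))
        (var (zv 1 k (2 * (t + 1))))))
      (conj (disj (neg (var (zv 1 k (2 * t)))) (disj (neg (var (zv 0 k (2 * row t + 1))))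
        (var (zv 1 k (2 * (t + 1))))))
      (disj (neg (var (zv 1 k (2 * t)))) (disj (neg (var (zv 1 k (2 * row t + 1))))
        (var (zv 0 k (2 * (t + 1)))))))))
    (fun _ _ => rfl) hacc hD0 hDn hKb hQ
    (fun c k t hk ht => hK3 c k _ hk (hKr t ht))
    (fun c k t hk ht => hK3 c k _ hk (hKa t ht))
    (fun t ht => hKhyp _ (hHLmem _ (hKr t ht)).1)
    (fun t ht => hKhyp _ (hHLmem _ (hKa t ht)).1)
    (fun t ht => hKhyp _ (hHLmem _ (hKr t ht)).2.1)
    (fun t ht => hKhyp _ (hHLmem _ (hKa t ht)).2.1)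
    (fun t ht ρ hρ => List.mem_append_left _ (List.mem_map_of_mem (hcl t ht ρ hρ)))
    (N := 6000) le_rfl (by show K.length + n + 6000 + 12 ≤ K.length + n + 6015; omega) q le_rfl
  rw [hodd] at hchain
  -- the contradiction
  have hYe : ∀ k, Y k (2 * q) = const false := fun k => by rw [hYdef, heven]; simp
  have href := sq_refute zv Y H3 n K (2 * q) hH3₁ hY hYe hKb hQ
    (fun c k hk => hK3 c k _ hk (hKa q le_rfl)) (hKhyp _ (hHLmem _ (hKa q le_rfl)).2.1)
    (N := 6000) le_rfl (by show K.length + 6000 + 12 ≤ K.length + n + 6015; omega) hchain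
  -- extract a derivation of `G`
  obtain ⟨π₀, hder, hGmem, hdepth, hsize⟩ := exists_derivation_of_sq_context (Q := Q) href hGbase
    (by show φ.length + HL.length + 3 ≤ K.length + n + 6015; omega)
  -- substitute the `MOD₂` formulas and transfer
  obtain ⟨σ, hσv, hσz, hS, hDσ⟩ := exists_modSubst n Dof
  have hax : ∀ H ∈ HL, PropFormMod.IsModAxiom ((PropFormMod.ofPropForm H).subst σ) := by
    intro H hH
    obtain ⟨κ, -, rfl | rfl | ⟨k, hk, rfl | rfl⟩⟩ := hHLcases H hH
    · exact isModAxiom_subst_ax1 (zv := zv) hσz κ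
    · exact isModAxiom_subst_ax2 (zv := zv) hσz κ
    · exact isModAxiom_subst_ax3 (zv := zv) hσv hσz 0 hk κ
    · exact isModAxiom_subst_ax3 (zv := zv) hσv hσz 1 hk κ
  obtain ⟨π, hπ, hπsize⟩ := exists_isModDepthProofOf_of_derivation (a := 2) hder hGmem
    (dp := 34) (sz := proofSize π₀) (fun ψ hψ => (hdepth ψ hψ).trans (by show 8 + 26 ≤ 34; norm_num))
    (fun ψ hψ => (size_le_proofSize hψ).1) (by show G.altDepth + 2 ≤ 34; omega) σ hS (by omega)
    hDσ hax
  have htarget : (PropFormMod.ofPropForm (neg (PropForm.ofCNF φ))).subst σ =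
      PropFormMod.ofPropForm (neg (PropForm.ofCNF φ)) := by
    refine subst_ofPropForm_eq_of_vars σ _ fun v hv => hσv v ?_
    simp only [PropForm.vars] at hv
    obtain ⟨C, hC, l, hl, rfl⟩ := exists_lit_of_mem_vars_ofCNF φ hv
    have h1 := CNF.lt_numVars_of_mem_of_mem hC hl
    have h2 := numVars_sumEncoding_le 1 E
    rw [← hφ, mul_one] at h2
    omega
  rw [htarget] at hπ
  -- bookkeeping of the bound
  have hlenπ₀ : π₀.length ≤ proofSize π₀ := (size_le_proofSize hGmem).2
  have hκ : κ Q = 300 * (K.length + n + 6015 + 3) * (K.length + n + 6015 + 3) + 100 := by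
    show 300 * (K.length + n + 6015 + 2 + 1) * (K.length + n + 6015 + 2 + 1) + 100 = _
    ring
  refine ⟨HL.length, _, K.length + n + 6015, G.size + 40, π, hπ, ?_, by rw [hKlen], ?_,
    le_rfl, ?_⟩
  · -- `hl ≤ (2m+1)(2n+2)`
    rw [hHLlen]
    exact Nat.mul_le_mul_right _ (by omega)
  · -- `M ≤ 25 hl + |ofCNF φ| + 41`
    omega
  · refine hπsize.trans ?_
    have eL : (2 : ℕ) ^ (6000 + 2) = 2 ^ 6002 := by rw [show (6000 : ℕ) + 2 = 6002 from rfl]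
    rw [eL] at hsize
    generalize (2 : ℕ) ^ 6002 = L at hsize ⊢
    have hsz : proofSize π₀ ≤ (((L + 3) * (n + 1) + (Finset.range q).sum (fun s =>
        2 ^ (Dof (2 * row s + 1)).card * ((L + 3) * (n + 1) +
          2 * (Dof (2 * row s + 1)).card + 5) + L + (L + 2) * (n + 1) + 5) +
        n * (L + 2) + L + 5 + 3 * φ.length + 3 * HL.length + 4) * κ Q + 8) *
        (Q.Λ * (Q.M + 14)) := hsize
    -- bound the chain budget by the closed form
    have hcard : ∀ s, (Dof (2 * row s + 1)).card ≤ n := fun s => by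
      calc (Dof (2 * row s + 1)).card ≤ (Finset.range n).card :=
            Finset.card_le_card fun v hv => Finset.mem_range.2 (hDn _ v hv)
        _ = n := Finset.card_range n
    have hsum : (Finset.range q).sum (fun s => 2 ^ (Dof (2 * row s + 1)).card *
        ((L + 3) * (n + 1) + 2 * (Dof (2 * row s + 1)).card + 5) +
        L + (L + 2) * (n + 1) + 5) ≤
        (2 * φ.length + m) * ((L + 3) * (n + 1) + 2 * n + 5) +
          m * (L + (L + 2) * (n + 1) + 5) := by
      rw [Finset.sum_add_distrib, Finset.sum_add_distrib, Finset.sum_add_distrib]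
      have h1 : (Finset.range q).sum (fun s => 2 ^ (Dof (2 * row s + 1)).card *
          ((L + 3) * (n + 1) + 2 * (Dof (2 * row s + 1)).card + 5)) ≤
          (2 * φ.length + m) * ((L + 3) * (n + 1) + 2 * n + 5) := by
        calc _ ≤ (Finset.range q).sum (fun s => 2 ^ (Dof (2 * row s + 1)).card *
              ((L + 3) * (n + 1) + 2 * n + 5)) :=
              Finset.sum_le_sum fun s _ => Nat.mul_le_mul_left _ (by have := hcard s; omega)
          _ = ((Finset.range q).sum fun s => 2 ^ (Dof (2 * row s + 1)).card) *
              ((L + 3) * (n + 1) + 2 * n + 5) := (Finset.sum_mul _ _ _).symm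
          _ ≤ _ := Nat.mul_le_mul_right _ hcount
      have h2 : (Finset.range q).sum (fun _ => L) +
          (Finset.range q).sum (fun _ => (L + 2) * (n + 1)) +
          (Finset.range q).sum (fun _ => 5) ≤ m * (L + (L + 2) * (n + 1) + 5) := by
        simp only [Finset.sum_const, Finset.card_range, smul_eq_mul]
        calc q * L + q * ((L + 2) * (n + 1)) + q * 5
            = q * (L + (L + 2) * (n + 1) + 5) := by ring
          _ ≤ m * (L + (L + 2) * (n + 1) + 5) := Nat.mul_le_mul_right _ hqm
      omega
    have hszb : proofSize π₀ ≤ ((((L + 3) * (n + 1) +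
        ((2 * φ.length + m) * ((L + 3) * (n + 1) + 2 * n + 5) +
          m * (L + (L + 2) * (n + 1) + 5)) + n * (L + 2) + L + 5) +
        3 * φ.length + 3 * HL.length + 4) *
        (300 * (K.length + n + 6015 + 3) * (K.length + n + 6015 + 3) + 100) + 8) *
        (64 * (K.length + n + 6015 + 4) * (G.size + 40 + 14)) := by
      refine hsz.trans ?_
      rw [hκ]
      refine Nat.mul_le_mul (Nat.add_le_add_right (Nat.mul_le_mul_right _ ?_) _) (le_of_eq rfl)
      omega
    have hadd : (L + 3) * (n + 1) + ((2 * φ.length + m) * ((L + 3) * (n + 1) +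
        2 * n + 5) + m * (L + (L + 2) * (n + 1) + 5)) + n * (L + 2) +
        L + 5 = (L + 3) * (n + 1) + (2 * φ.length + m) * ((L + 3) * (n + 1) +
        2 * n + 5) + m * (L + (L + 2) * (n + 1) + 5) + n * (L + 2) +
        L + 5 := by ring
    rw [hadd] at hszb
    exact Nat.mul_le_mul (by omega) (Nat.mul_le_mul_right _ (by omega))

end Summit.PneNP.PneNP.Theorems.ModTwo
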